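import Literature.NumberTheory.ModularForms.EisensteinE4Hypergeometric
import Mathlib.Analysis.SpecialFunctions.Pow.Deriv
import Mathlib.Tactic.Linarith
import Mathlib.Tactic.Positivity
import Mathlib.Tactic.FieldSimp
import Mathlib.Tactic.Ring
import Mathlib.Tactic.LinearCombination
import HarnessLib

/-!
# Gauss's quadratic transformation `₂F₁(a,b;2b;4x/(1+x)²) = (1+x)^{2a} ₂F₁(a, a−b+½; b+½; x²)`, part 1: Rainville's differential equation and Abel's identity

M. Swathi, A. K. Rathie, R. B. Paris, *A derivation of two quadratic transformations contiguous to that of Gauss via a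
differential equation approach*, arXiv:1411.5262 (2014) (Applied Mathematical Sciences 9 (2015)), §1 eq. (1.1): «The
quadratic transformation for the Gauss hypergeometric function ₂F₁(a,b;c;x) we consider here is the one originally obtained by
Gauss in the form (see, for example, [AAR]) `(1+x)^{-2a} ₂F₁(a, b; 2b; 4x/(1+x)²) = ₂F₁(a, a−b+½; b+½; x²)` valid when `|x| < 1`
and `|4x/(1+x)²| < 1` and provided `2b` is neither zero nor a negative integer», and §2 «Derivation of (1.1) by Rainville's
method»: with `c = 2b` and `z = 4x/(1+x)²` the hypergeometric equation becomes (2.1)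
`x(1−x)(1+x)² w'' + 2(1+x){b − 2ax + (b−1)x²} w' − 4(1−x)ab·w = 0`, and `w = (1+x)^{2a} y` turns it into (2.2)
`x(1−x²) y'' + 2{b − (2a−b+1)x²} y' − 2ax(1+2a−2b) y = 0`, which in `v = x²` is the hypergeometric equation (2.3) with
parameters `(a, a−b+½; b+½)`; Rainville then concludes by a Frobenius argument at `x = 0`.

This file (part 1 of 2; part 2 is `HypergeometricQuadraticGauss`) formalises the CALCULUS of that route for Mathlib's REAL
`ordinaryHypergeometric`, on `0 < x < 1` (so that both arguments lie in `(0,1)`), for real parameters with `b > 0`: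

* `gaussQuadraticLeft_deriv_data`, `gaussQuadraticRight_deriv_data` — first and second derivatives of
  `W(x) := ₂F₁(a,b;2b;4x/(1+x)²)` (`z' = 4(1−x)/(1+x)³`, `z'' = 8(x−2)/(1+x)⁴`) and of
  `W₂(x) := (1+x)^{2a}·₂F₁(a, a−b+½; b+½; x²)`, by the chain and product rules from the tree's real derivative formula
  `d/dx ₂F₁(a,b;c;x) = (ab/c) ₂F₁(a+1,b+1;c+1;x)` (`Literature.NumberTheory.Automorphic.LegendreP.hasDerivAt_ordinaryHypergeometric`,
  used by name);
* **`gaussQuadraticLeft_ode`**, **`gaussQuadraticRight_ode`** — BOTH `W` and `W₂` solve (2.1) on `(0,1)` (for `W`: `4(1−x)` times the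
  hypergeometric equation at `4x/(1+x)²`; for `W₂`: `4x(1+x)^{2a+1}` times the hypergeometric equation with parameters
  `(a, a−b+½; b+½)` at `x²`; the tree's real `Literature.NumberTheory.ModularForms.ordinaryHypergeometric_ode`, `c > 0`, used by name);
* **`hasDerivAt_gaussQuadratic_wronskian`** — ABEL'S IDENTITY for (2.1): with the weight
  `ω(x) = x^{2b}(1−x)^{1+2a−2b}(1+x)^{1−2a−2b}` (logarithmic derivative `2b/x + (2b−2a−1)/(1−x) + (1−2a−2b)/(1+x)` = the
  coefficient ratio of (2.1)), `Z := ω·(W·W₂' − W'·W₂)` has zero derivative on `(0,1)`.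

Relation to the tree: the special case `a = b = h` of this calculus (weight `x^{2h}(1−x)(1+x)^{1−4h}`) was landed earlier for the
2D-control programme under `Summits/CriticalPhenomena/Ising3D/Control2DRadialEquation.lean` (a Summits file, which a Literature
file may not import); the lemmas here are the PARAMETRIC `(a, b)` versions, re-derived — new content at general parameters, not a
copy. NOT claimed here: the transformation itself (part 2); complex argument; `|x| ≥ 1` or `x ≤ 0`; `b ≤ 0`; connection formulae.

## References
* [SwathiRathieParis2014] M. Swathi, A. K. Rathie, R. B. Paris, arXiv:1411.5262, §1 (1.1), §2 (2.1)–(2.3).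
* [AndrewsAskeyRoy1999] G. E. Andrews, R. Askey, R. Roy, *Special Functions*, CUP 1999, §3.1 (quadratic transformations).
-/

noncomputable section

open Set Filter Topology

namespace Literature.Analysis.SpecialFunctions.Hypergeometric

open Literature.NumberTheory.Automorphic.LegendreP (hasDerivAt_ordinaryHypergeometric)
open Literature.NumberTheory.ModularForms (ordinaryHypergeometric_ode)

/-! ## The left-hand side `W(x) = ₂F₁(a,b;2b;4x/(1+x)²)` -/

/-- Derivative data of `W(x) = ₂F₁(a,b;2b;4x/(1+x)²)` on `(0,1)`: `W' = g₁(z)·z'`, `W'' = g₂(z)·z'² + g₁(z)·z''` with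
`z = 4x/(1+x)²`, `z' = 4(1−x)/(1+x)³`, `z'' = 8(x−2)/(1+x)⁴`, `g₁ = (ab/(2b)) ₂F₁(a+1,b+1;2b+1;·)`,
`g₂ = (ab/(2b))((a+1)(b+1)/(2b+1)) ₂F₁(a+2,b+2;2b+2;·)` (chain rule with the tree's `d/dx ₂F₁ = (ab/c) ₂F₁(a+1,b+1;c+1;·)`).
[cite: SwathiRathieParis2014, §2] -/
theorem gaussQuadraticLeft_deriv_data (a b : ℝ) {x : ℝ} (hx : x ∈ Ioo (0 : ℝ) 1) :
    let g₁ := a * b / (2 * b) * ordinaryHypergeometric (a + 1) (b + 1) (2 * b + 1) (4 * x / (1 + x) ^ 2)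
    let g₂ := a * b / (2 * b) * ((a + 1) * (b + 1) / (2 * b + 1) *
      ordinaryHypergeometric (a + 1 + 1) (b + 1 + 1) (2 * b + 1 + 1) (4 * x / (1 + x) ^ 2))
    HasDerivAt (fun r : ℝ => ordinaryHypergeometric a b (2 * b) (4 * r / (1 + r) ^ 2))
        (g₁ * (4 * (1 - x) / (1 + x) ^ 3)) x ∧
      HasDerivAt (deriv fun r : ℝ => ordinaryHypergeometric a b (2 * b) (4 * r / (1 + r) ^ 2))
        (g₂ * (4 * (1 - x) / (1 + x) ^ 3) * (4 * (1 - x) / (1 + x) ^ 3) +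
          g₁ * (8 * (x - 2) / (1 + x) ^ 4)) x := by
  intro g₁ g₂
  -- `0 < 4r/(1+r)² < 1` on `(0,1)` (`< 1 ⇔ (1-r)² > 0`)
  have hzI : ∀ r ∈ Ioo (0 : ℝ) 1, 0 < 4 * r / (1 + r) ^ 2 ∧ 4 * r / (1 + r) ^ 2 < 1 := fun r hr => by
    have h1 : 0 < (1 + r) ^ 2 := by nlinarith [hr.1]
    refine ⟨div_pos (by linarith [hr.1]) h1, ?_⟩
    rw [div_lt_one h1]
    nlinarith [hr.1, hr.2, sq_nonneg (1 - r)]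
  have hz : ∀ r ∈ Ioo (0 : ℝ) 1, |4 * r / (1 + r) ^ 2| < 1 := fun r hr => by
    rw [abs_of_pos (hzI r hr).1]; exact (hzI r hr).2
  have hne : ∀ r ∈ Ioo (0 : ℝ) 1, 1 + r ≠ 0 := fun r hr => by linarith [hr.1]
  -- `z' = 4(1-r)/(1+r)³`
  have hZ : ∀ r ∈ Ioo (0 : ℝ) 1, HasDerivAt (fun r : ℝ => 4 * r / (1 + r) ^ 2) (4 * (1 - r) / (1 + r) ^ 3) r := by
    intro r hr
    have hnum : HasDerivAt (fun r : ℝ => 4 * r) 4 r := by simpa using (hasDerivAt_id r).const_mul 4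
    have hden : HasDerivAt (fun r : ℝ => (1 + r) ^ 2) (2 * (1 + r)) r :=
      (((hasDerivAt_id' r).const_add 1).fun_pow 2).congr_deriv (by norm_num)
    refine (hnum.div hden (pow_ne_zero 2 (hne r hr))).congr_deriv ?_
    field_simp [hne r hr]
    ring
  -- `z'' = 8(r-2)/(1+r)⁴`
  have hZ' : HasDerivAt (fun r : ℝ => 4 * (1 - r) / (1 + r) ^ 3) (8 * (x - 2) / (1 + x) ^ 4) x := by
    have hnum : HasDerivAt (fun r : ℝ => 4 * (1 - r)) (-4) x := by
      simpa using ((hasDerivAt_id x).const_sub 1).const_mul 4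
    have hden : HasDerivAt (fun r : ℝ => (1 + r) ^ 3) (3 * (1 + x) ^ 2) x :=
      (((hasDerivAt_id' x).const_add 1).fun_pow 3).congr_deriv (by norm_num)
    refine (hnum.div hden (pow_ne_zero 3 (hne x hx))).congr_deriv ?_
    field_simp [hne x hx]
    ring
  -- first derivative at every point of the open interval
  have hd1 : ∀ r ∈ Ioo (0 : ℝ) 1,
      HasDerivAt (fun r : ℝ => ordinaryHypergeometric a b (2 * b) (4 * r / (1 + r) ^ 2))
        (a * b / (2 * b) * ordinaryHypergeometric (a + 1) (b + 1) (2 * b + 1) (4 * r / (1 + r) ^ 2) *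
          (4 * (1 - r) / (1 + r) ^ 3)) r := by
    intro r hr
    exact (hasDerivAt_ordinaryHypergeometric (a := a) (b := b) (c := 2 * b) (hz r hr)).comp r (hZ r hr)
  refine ⟨hd1 x hx, ?_⟩
  have hev : deriv (fun r : ℝ => ordinaryHypergeometric a b (2 * b) (4 * r / (1 + r) ^ 2)) =ᶠ[𝓝 x]
      fun r => a * b / (2 * b) * ordinaryHypergeometric (a + 1) (b + 1) (2 * b + 1) (4 * r / (1 + r) ^ 2) *
        (4 * (1 - r) / (1 + r) ^ 3) := by
    filter_upwards [Ioo_mem_nhds hx.1 hx.2] with r hr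
    exact (hd1 r hr).deriv
  have h2 := ((hasDerivAt_ordinaryHypergeometric (a := a + 1) (b := b + 1) (c := 2 * b + 1) (hz x hx)).comp x
    (hZ x hx)).const_mul (a * b / (2 * b))
  have h3 := h2.fun_mul hZ'
  refine (h3.congr_of_eventuallyEq (hev.trans (Eventually.of_forall fun r => by
    simp only [Function.comp_apply]))).congr_deriv ?_
  simp only [Function.comp_apply]
  ring

/-- **Equation (2.1) for the left-hand side** (`b > 0`, `0 < x < 1`), with `W(x) = ₂F₁(a,b;2b;4x/(1+x)²)`:
`x(1−x)(1+x)²·W'' + 2(1+x)(b − 2ax + (b−1)x²)·W' − 4(1−x)ab·W = 0` — it is `4(1−x)` times the hypergeometric equation of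
`₂F₁(a,b;2b;·)` at `4x/(1+x)²` (the tree's real `ordinaryHypergeometric_ode`, by name), by the chain rule.
[cite: SwathiRathieParis2014, §2 eq. (2.1)] -/
theorem gaussQuadraticLeft_ode {a b : ℝ} (hb : 0 < b) {x : ℝ} (hx : x ∈ Ioo (0 : ℝ) 1) :
    x * (1 - x) * (1 + x) ^ 2 *
        deriv (deriv fun r : ℝ => ordinaryHypergeometric a b (2 * b) (4 * r / (1 + r) ^ 2)) x +
      2 * (1 + x) * (b - 2 * a * x + (b - 1) * x ^ 2) *
        deriv (fun r : ℝ => ordinaryHypergeometric a b (2 * b) (4 * r / (1 + r) ^ 2)) x -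
      4 * (1 - x) * a * b * ordinaryHypergeometric a b (2 * b) (4 * x / (1 + x) ^ 2) = 0 := by
  obtain ⟨hd, hdd⟩ := gaussQuadraticLeft_deriv_data a b hx
  have hz : |4 * x / (1 + x) ^ 2| < 1 := by
    have h1 : 0 < (1 + x) ^ 2 := by nlinarith [hx.1]
    rw [abs_of_pos (div_pos (by linarith [hx.1]) h1), div_lt_one h1]
    nlinarith [hx.1, hx.2, sq_nonneg (1 - x)]
  have hode := ordinaryHypergeometric_ode (a := a) (b := b) (c := 2 * b) (by positivity) hz
  rw [hd.deriv, hdd.deriv]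
  have h1 : (1 : ℝ) + x ≠ 0 := by linarith [hx.1]
  have hb2 : (2 : ℝ) * b ≠ 0 := by positivity
  have hb3 : (2 : ℝ) * b + 1 ≠ 0 := by positivity
  set G₀ := ordinaryHypergeometric a b (2 * b) (4 * x / (1 + x) ^ 2)
  set G₁ := ordinaryHypergeometric (a + 1) (b + 1) (2 * b + 1) (4 * x / (1 + x) ^ 2)
  set G₂ := ordinaryHypergeometric (a + 1 + 1) (b + 1 + 1) (2 * b + 1 + 1) (4 * x / (1 + x) ^ 2)
  have key : x * (1 - x) * (1 + x) ^ 2 *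
        (a * b / (2 * b) * ((a + 1) * (b + 1) / (2 * b + 1) * G₂) * (4 * (1 - x) / (1 + x) ^ 3) *
            (4 * (1 - x) / (1 + x) ^ 3) +
          a * b / (2 * b) * G₁ * (8 * (x - 2) / (1 + x) ^ 4)) +
      2 * (1 + x) * (b - 2 * a * x + (b - 1) * x ^ 2) * (a * b / (2 * b) * G₁ * (4 * (1 - x) / (1 + x) ^ 3)) -
      4 * (1 - x) * a * b * G₀ =
      4 * (1 - x) *
        (4 * x / (1 + x) ^ 2 * (1 - 4 * x / (1 + x) ^ 2) *
            (a * b / (2 * b) * ((a + 1) * (b + 1) / (2 * b + 1) * G₂)) +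
          (2 * b - (a + b + 1) * (4 * x / (1 + x) ^ 2)) * (a * b / (2 * b) * G₁) - a * b * G₀) := by
    field_simp
    ring
  rw [key, hode, mul_zero]

/-! ## The right-hand side `W₂(x) = (1+x)^{2a} ₂F₁(a, a−b+½; b+½; x²)` -/

/-- Derivative data of `W₂(x) = (1+x)^{2a}·₂F₁(a, a−b+½; b+½; x²)` on `(0,1)`: with `u = (1+x)^{2a}`, `u' = 2a(1+x)^{2a−1}`,
`u'' = 2a(2a−1)(1+x)^{2a−2}`, `G = ₂F₁(a,a−b+½;b+½;x²)`, `G' = 2x k₁(x²)`, `G'' = 4x² k₂(x²) + 2k₁(x²)`: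
`W₂' = u'G + uG'`, `W₂'' = u''G + 2u'G' + uG''`. [cite: SwathiRathieParis2014, §2] -/
theorem gaussQuadraticRight_deriv_data (a b : ℝ) {x : ℝ} (hx : x ∈ Ioo (0 : ℝ) 1) :
    let k₀ := ordinaryHypergeometric a (a - b + 1 / 2) (b + 1 / 2) (x ^ 2)
    let k₁ := a * (a - b + 1 / 2) / (b + 1 / 2) * ordinaryHypergeometric (a + 1) (a - b + 1 / 2 + 1) (b + 1 / 2 + 1) (x ^ 2)
    let k₂ := a * (a - b + 1 / 2) / (b + 1 / 2) * ((a + 1) * (a - b + 1 / 2 + 1) / (b + 1 / 2 + 1) *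
      ordinaryHypergeometric (a + 1 + 1) (a - b + 1 / 2 + 1 + 1) (b + 1 / 2 + 1 + 1) (x ^ 2))
    let u := (1 + x) ^ (2 * a)
    let u₁ := 2 * a * (1 + x) ^ (2 * a - 1)
    let u₂ := 2 * a * ((2 * a - 1) * (1 + x) ^ (2 * a - 1 - 1))
    HasDerivAt (fun r : ℝ => (1 + r) ^ (2 * a) * ordinaryHypergeometric a (a - b + 1 / 2) (b + 1 / 2) (r ^ 2))
        (u₁ * k₀ + u * (k₁ * (2 * x))) x ∧
      HasDerivAt
        (deriv fun r : ℝ => (1 + r) ^ (2 * a) * ordinaryHypergeometric a (a - b + 1 / 2) (b + 1 / 2) (r ^ 2))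
        (u₂ * k₀ + u₁ * (k₁ * (2 * x)) + (u₁ * (k₁ * (2 * x)) + u * (k₂ * (2 * x) * (2 * x) + k₁ * 2))) x := by
  intro k₀ k₁ k₂ u u₁ u₂
  have hpos : ∀ r ∈ Ioo (0 : ℝ) 1, 0 < 1 + r := fun r hr => by linarith [hr.1]
  have habs : ∀ r ∈ Ioo (0 : ℝ) 1, |r ^ 2| < 1 := fun r hr => by
    rw [abs_of_nonneg (sq_nonneg r)]; nlinarith [hr.1, hr.2]
  have hsq : ∀ r : ℝ, HasDerivAt (fun r : ℝ => r ^ 2) (2 * r) r := fun r => by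
    simpa using hasDerivAt_pow 2 r
  -- `d/dr (1+r)^p = p (1+r)^{p-1}` for `1 + r > 0`
  have hP : ∀ r ∈ Ioo (0 : ℝ) 1, ∀ p : ℝ, HasDerivAt (fun r : ℝ => (1 + r) ^ p) (p * (1 + r) ^ (p - 1)) r := by
    intro r hr p
    have h := (Real.hasDerivAt_rpow_const (x := 1 + r) (p := p) (Or.inl (hpos r hr).ne')).comp r
      ((hasDerivAt_id' r).const_add 1)
    exact (h.congr_of_eventuallyEq (Eventually.of_forall fun r => rfl)).congr_deriv (mul_one _)
  have hd1 : ∀ r ∈ Ioo (0 : ℝ) 1,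
      HasDerivAt (fun r : ℝ => (1 + r) ^ (2 * a) * ordinaryHypergeometric a (a - b + 1 / 2) (b + 1 / 2) (r ^ 2))
        (2 * a * (1 + r) ^ (2 * a - 1) * ordinaryHypergeometric a (a - b + 1 / 2) (b + 1 / 2) (r ^ 2) +
          (1 + r) ^ (2 * a) * (a * (a - b + 1 / 2) / (b + 1 / 2) *
            ordinaryHypergeometric (a + 1) (a - b + 1 / 2 + 1) (b + 1 / 2 + 1) (r ^ 2) * (2 * r))) r := by
    intro r hr
    have hG := (hasDerivAt_ordinaryHypergeometric (a := a) (b := a - b + 1 / 2) (c := b + 1 / 2)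
      (habs r hr)).comp (h := fun r : ℝ => r ^ 2) r (hsq r)
    exact (hP r hr (2 * a)).mul hG
  refine ⟨hd1 x hx, ?_⟩
  have hev : deriv (fun r : ℝ => (1 + r) ^ (2 * a) * ordinaryHypergeometric a (a - b + 1 / 2) (b + 1 / 2) (r ^ 2))
      =ᶠ[𝓝 x] fun r => 2 * a * (1 + r) ^ (2 * a - 1) * ordinaryHypergeometric a (a - b + 1 / 2) (b + 1 / 2) (r ^ 2) +
          (1 + r) ^ (2 * a) * (a * (a - b + 1 / 2) / (b + 1 / 2) *
            ordinaryHypergeometric (a + 1) (a - b + 1 / 2 + 1) (b + 1 / 2 + 1) (r ^ 2) * (2 * r)) := by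
    filter_upwards [Ioo_mem_nhds hx.1 hx.2] with r hr
    exact (hd1 r hr).deriv
  have hu : HasDerivAt (fun r : ℝ => (1 + r) ^ (2 * a)) u₁ x := hP x hx (2 * a)
  have hu₁ : HasDerivAt (fun r : ℝ => 2 * a * (1 + r) ^ (2 * a - 1)) u₂ x := (hP x hx (2 * a - 1)).const_mul (2 * a)
  have hG : HasDerivAt (fun r : ℝ => ordinaryHypergeometric a (a - b + 1 / 2) (b + 1 / 2) (r ^ 2)) (k₁ * (2 * x)) x :=
    (hasDerivAt_ordinaryHypergeometric (a := a) (b := a - b + 1 / 2) (c := b + 1 / 2)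
      (habs x hx)).comp (h := fun r : ℝ => r ^ 2) x (hsq x)
  have hG₁ : HasDerivAt (fun r : ℝ => a * (a - b + 1 / 2) / (b + 1 / 2) *
      ordinaryHypergeometric (a + 1) (a - b + 1 / 2 + 1) (b + 1 / 2 + 1) (r ^ 2) * (2 * r))
      (k₂ * (2 * x) * (2 * x) + k₁ * 2) x := by
    have h2 := ((hasDerivAt_ordinaryHypergeometric (a := a + 1) (b := a - b + 1 / 2 + 1) (c := b + 1 / 2 + 1)
      (habs x hx)).comp (h := fun r : ℝ => r ^ 2) x (hsq x)).const_mul (a * (a - b + 1 / 2) / (b + 1 / 2))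
    have hlin : HasDerivAt (fun y : ℝ => 2 * y) 2 x := by simpa using (hasDerivAt_id' x).const_mul 2
    have h3 := h2.mul hlin
    refine (h3.congr_of_eventuallyEq (Eventually.of_forall fun r => by
      simp only [Function.comp_apply, Pi.mul_apply])).congr_deriv ?_
    simp only [Function.comp_apply]
    ring
  have h4 := (hu₁.mul hG).add (hu.mul hG₁)
  refine (h4.congr_of_eventuallyEq (hev.trans (Eventually.of_forall fun r => by
    simp only [Pi.add_apply, Pi.mul_apply]))).congr_deriv ?_
  ring

/-- **Equation (2.1) for the right-hand side** (`b > 0`, `0 < x < 1`), with `W₂(x) = (1+x)^{2a}·₂F₁(a, a−b+½; b+½; x²)`: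
`x(1−x)(1+x)²·W₂'' + 2(1+x)(b − 2ax + (b−1)x²)·W₂' − 4(1−x)ab·W₂ = 0` — it is `4x(1+x)^{2a+1}` times the hypergeometric
equation with parameters `(a, a−b+½; b+½)` at `x²` (eq. (2.3) — the tree's real `ordinaryHypergeometric_ode`, by name), i.e.
`(1+x)^{2a+1}` times Rainville's equation (2.2) for `y = ₂F₁(a,a−b+½;b+½;x²)`. [cite: SwathiRathieParis2014, §2 eq. (2.2)–(2.3)] -/
theorem gaussQuadraticRight_ode {a b : ℝ} (hb : 0 < b) {x : ℝ} (hx : x ∈ Ioo (0 : ℝ) 1) :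
    x * (1 - x) * (1 + x) ^ 2 *
        deriv (deriv fun r : ℝ => (1 + r) ^ (2 * a) * ordinaryHypergeometric a (a - b + 1 / 2) (b + 1 / 2) (r ^ 2)) x +
      2 * (1 + x) * (b - 2 * a * x + (b - 1) * x ^ 2) *
        deriv (fun r : ℝ => (1 + r) ^ (2 * a) * ordinaryHypergeometric a (a - b + 1 / 2) (b + 1 / 2) (r ^ 2)) x -
      4 * (1 - x) * a * b *
        ((1 + x) ^ (2 * a) * ordinaryHypergeometric a (a - b + 1 / 2) (b + 1 / 2) (x ^ 2)) = 0 := by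
  obtain ⟨hd, hdd⟩ := gaussQuadraticRight_deriv_data a b hx
  have habs : |x ^ 2| < 1 := by rw [abs_of_nonneg (sq_nonneg x)]; nlinarith [hx.1, hx.2]
  have hode := ordinaryHypergeometric_ode (a := a) (b := a - b + 1 / 2) (c := b + 1 / 2) (by positivity) habs
  rw [hd.deriv, hdd.deriv]
  have h1 : (0 : ℝ) < 1 + x := by linarith [hx.1]
  have hr1 : (1 + x) ^ (2 * a - 1) = (1 + x) ^ (2 * a) / (1 + x) := by
    rw [Real.rpow_sub h1, Real.rpow_one]
  have hr2 : (1 + x) ^ (2 * a - 1 - 1) = (1 + x) ^ (2 * a) / (1 + x) ^ 2 := by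
    rw [show 2 * a - 1 - 1 = 2 * a - 2 by ring, Real.rpow_sub h1, Real.rpow_two]
  rw [hr1, hr2]
  set U := (1 + x) ^ (2 * a)
  set K₀ := ordinaryHypergeometric a (a - b + 1 / 2) (b + 1 / 2) (x ^ 2)
  set K₁ := ordinaryHypergeometric (a + 1) (a - b + 1 / 2 + 1) (b + 1 / 2 + 1) (x ^ 2)
  set K₂ := ordinaryHypergeometric (a + 1 + 1) (a - b + 1 / 2 + 1 + 1) (b + 1 / 2 + 1 + 1) (x ^ 2)
  have h1' : (1 : ℝ) + x ≠ 0 := h1.ne'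
  have hc : (b : ℝ) + 1 / 2 ≠ 0 := by positivity
  have hc' : (b : ℝ) + 1 / 2 + 1 ≠ 0 := by positivity
  have key : x * (1 - x) * (1 + x) ^ 2 *
        (2 * a * ((2 * a - 1) * (U / (1 + x) ^ 2)) * K₀ +
            2 * a * (U / (1 + x)) * (a * (a - b + 1 / 2) / (b + 1 / 2) * K₁ * (2 * x)) +
          (2 * a * (U / (1 + x)) * (a * (a - b + 1 / 2) / (b + 1 / 2) * K₁ * (2 * x)) +
            U * (a * (a - b + 1 / 2) / (b + 1 / 2) * ((a + 1) * (a - b + 1 / 2 + 1) / (b + 1 / 2 + 1) * K₂) * (2 * x) *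
                (2 * x) +
              a * (a - b + 1 / 2) / (b + 1 / 2) * K₁ * 2))) +
      2 * (1 + x) * (b - 2 * a * x + (b - 1) * x ^ 2) *
        (2 * a * (U / (1 + x)) * K₀ + U * (a * (a - b + 1 / 2) / (b + 1 / 2) * K₁ * (2 * x))) -
      4 * (1 - x) * a * b * (U * K₀) =
      4 * x * (1 + x) * U *
        (x ^ 2 * (1 - x ^ 2) *
            (a * (a - b + 1 / 2) / (b + 1 / 2) * ((a + 1) * (a - b + 1 / 2 + 1) / (b + 1 / 2 + 1) * K₂)) +
          (b + 1 / 2 - (a + (a - b + 1 / 2) + 1) * x ^ 2) * (a * (a - b + 1 / 2) / (b + 1 / 2) * K₁) -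
          a * (a - b + 1 / 2) * K₀) := by
    field_simp
    ring
  rw [key, hode, mul_zero]

/-! ## Abel's identity for equation (2.1) -/

/-- **Abel's identity for (2.1).** With `W(x) = ₂F₁(a,b;2b;4x/(1+x)²)`, `W₂(x) = (1+x)^{2a}₂F₁(a,a−b+½;b+½;x²)` and the
weight `ω(x) = x^{2b}(1−x)^{1+2a−2b}(1+x)^{1−2a−2b}` (whose logarithmic derivative
`2b/x − (1+2a−2b)/(1−x) + (1−2a−2b)/(1+x)` is the ratio of the `w'`- to the `w''`-coefficient of (2.1)),
`Z := ω·(W·W₂' − W'·W₂)` has zero derivative on `(0,1)` (`b > 0`). [cite: SwathiRathieParis2014, §2 eq. (2.1)] -/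
theorem hasDerivAt_gaussQuadratic_wronskian {a b : ℝ} (hb : 0 < b) {x : ℝ} (hx : x ∈ Ioo (0 : ℝ) 1) :
    HasDerivAt (fun r : ℝ => r ^ (2 * b) * (1 - r) ^ (1 + 2 * a - 2 * b) * (1 + r) ^ (1 - 2 * a - 2 * b) *
      (ordinaryHypergeometric a b (2 * b) (4 * r / (1 + r) ^ 2) *
          deriv (fun r : ℝ => (1 + r) ^ (2 * a) * ordinaryHypergeometric a (a - b + 1 / 2) (b + 1 / 2) (r ^ 2)) r -
        deriv (fun r : ℝ => ordinaryHypergeometric a b (2 * b) (4 * r / (1 + r) ^ 2)) r *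
          ((1 + r) ^ (2 * a) * ordinaryHypergeometric a (a - b + 1 / 2) (b + 1 / 2) (r ^ 2)))) 0 x := by
  set Yf : ℝ → ℝ := fun r => ordinaryHypergeometric a b (2 * b) (4 * r / (1 + r) ^ 2) with hYf
  set Vf : ℝ → ℝ := fun r => (1 + r) ^ (2 * a) * ordinaryHypergeometric a (a - b + 1 / 2) (b + 1 / 2) (r ^ 2)
    with hVf
  have hx0 : 0 < x := hx.1
  have h1 : (0 : ℝ) < 1 + x := by linarith
  have h2 : (0 : ℝ) < 1 - x := by linarith [hx.2]
  have hd : x * (1 - x) * (1 + x) ^ 2 ≠ 0 := by positivity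
  obtain ⟨hY, hY'⟩ := gaussQuadraticLeft_deriv_data a b hx
  obtain ⟨hV, hV'⟩ := gaussQuadraticRight_deriv_data a b hx
  have hYd : HasDerivAt Yf (deriv Yf x) x := hY.differentiableAt.hasDerivAt
  have hY'd : HasDerivAt (deriv Yf) (deriv (deriv Yf) x) x := hY'.differentiableAt.hasDerivAt
  have hVd : HasDerivAt Vf (deriv Vf x) x := hV.differentiableAt.hasDerivAt
  have hV'd : HasDerivAt (deriv Vf) (deriv (deriv Vf) x) x := hV'.differentiableAt.hasDerivAt
  have hodeY := gaussQuadraticLeft_ode (a := a) hb hx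
  have hodeV := gaussQuadraticRight_ode (a := a) hb hx
  have eY : deriv (deriv Yf) x = (4 * (1 - x) * a * b * Yf x -
      2 * (1 + x) * (b - 2 * a * x + (b - 1) * x ^ 2) * deriv Yf x) / (x * (1 - x) * (1 + x) ^ 2) := by
    rw [eq_div_iff hd]; simp only [hYf]; linarith [hodeY]
  have eV : deriv (deriv Vf) x = (4 * (1 - x) * a * b * Vf x -
      2 * (1 + x) * (b - 2 * a * x + (b - 1) * x ^ 2) * deriv Vf x) / (x * (1 - x) * (1 + x) ^ 2) := by
    rw [eq_div_iff hd]; simp only [hVf]; linarith [hodeV]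
  -- the weight and its derivative
  have hA : HasDerivAt (fun r : ℝ => r ^ (2 * b)) (2 * b * x ^ (2 * b - 1)) x :=
    Real.hasDerivAt_rpow_const (Or.inl hx0.ne')
  have hB : HasDerivAt (fun r : ℝ => (1 - r) ^ (1 + 2 * a - 2 * b))
      ((1 + 2 * a - 2 * b) * (1 - x) ^ (1 + 2 * a - 2 * b - 1) * (-1)) x := by
    have h := (Real.hasDerivAt_rpow_const (x := 1 - x) (p := 1 + 2 * a - 2 * b) (Or.inl h2.ne')).comp x
      ((hasDerivAt_id' x).const_sub 1)
    exact h.congr_of_eventuallyEq (Eventually.of_forall fun r => rfl)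
  have hC : HasDerivAt (fun r : ℝ => (1 + r) ^ (1 - 2 * a - 2 * b))
      ((1 - 2 * a - 2 * b) * (1 + x) ^ (1 - 2 * a - 2 * b - 1)) x := by
    have h := (Real.hasDerivAt_rpow_const (x := 1 + x) (p := 1 - 2 * a - 2 * b) (Or.inl h1.ne')).comp x
      ((hasDerivAt_id' x).const_add 1)
    exact (h.congr_of_eventuallyEq (Eventually.of_forall fun r => rfl)).congr_deriv (mul_one _)
  have hw := (hA.mul hB).mul hC
  have hW := (hYd.mul hV'd).sub (hY'd.mul hVd)
  have hZ := hw.mul hW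
  refine (hZ.congr_of_eventuallyEq (Eventually.of_forall fun r => by
    simp only [Pi.mul_apply, Pi.sub_apply, hYf, hVf])).congr_deriv ?_
  have hrA : x ^ (2 * b - 1) = x ^ (2 * b) / x := Real.rpow_sub_one hx0.ne' _
  have hrB : (1 - x) ^ (1 + 2 * a - 2 * b - 1) = (1 - x) ^ (1 + 2 * a - 2 * b) / (1 - x) :=
    Real.rpow_sub_one h2.ne' _
  have hrC : (1 + x) ^ (1 - 2 * a - 2 * b - 1) = (1 + x) ^ (1 - 2 * a - 2 * b) / (1 + x) :=
    Real.rpow_sub_one h1.ne' _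
  simp only [Pi.mul_apply, Pi.sub_apply]
  rw [hrA, hrB, hrC, eY, eV]
  have h1' : (1 : ℝ) + x ≠ 0 := h1.ne'
  have h2' : (1 : ℝ) - x ≠ 0 := h2.ne'
  field_simp
  ring

end Literature.Analysis.SpecialFunctions.Hypergeometric

end
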